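import Summits.ABC.ABC.Theses.CuspFieldPencil
import Literature.NumberTheory.EllipticCurves.IntegralModelMinimalScalingProofs
import Literature.NumberTheory.EllipticCurves.SzpiroFreyProofs
import Literature.NumberTheory.DiophantineGeometry.MinimalDiscriminantFactorizationProofs
import Literature.NumberTheory.DiophantineGeometry.ConductorFactorizationProofs
import HarnessLib

/-!
# The five-torsion dictionary: Tate's algorithm away from `5` on the Tate normal form `W(u, w)`

`Summits/ABC/ABC/Theorems/CuspFieldPencilFiveTorsionDictionary.lean` — proves the support item
stmt-ABC-26028 `Summit.ABC.ABC.Theses.CuspFieldPencil.FiveTorsionDictionary` of the (draft)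
class-record route `CuspFieldPencil` (abc-idea-2 g2), on the pattern of
`Summit.ABC.ABC.Theorems.sixTorsionDictionary_proof` (file
`RationalCuspPencilSixTorsionDictionary.lean`) and `Summit.ABC.ABC.Theorems.twoTorsionDictionary_proof`
(file `TwoTorsionDictionary.lean`); as there, the two generic steps `Δ_min ∣ Δ(W₀)` and "a radical
divides once every prime does" are inlined (route-independent imports).

**Statement.** For coprime integers `u, w` with `u w (u² − 11uw − w²) ≠ 0` and every elliptic
`W = ⟨w−u, −uw, −uw², 0, 0⟩ / ℚ` (the Tate normal form `E(t, t)`, `t = u/w`, of a curve with a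
rational point of order five, made integral):

* `|Δ_min(W)| ≤ |u⁵ w⁵ (u² − 11uw − w²)|` — the right-hand side is `|Δ|` of the integral equation
  (`Δ_eq`, an identity of polynomials in the five coefficients), and `Δ_min` divides the
  discriminant of any integral equation [Silverman AEC VII.1 Remark 1.1];
* `rad(u w (u² − 11uw − w²)) ∣ 5 · N_W` — at a prime `p ≠ 5` dividing one of the cusp forms
  `u`, `w`, `Q = u² − 11uw − w²` the integral equation has `p ∤ c₄`: indeed
  `c₄ = u⁴ − 12u³w + 14u²w² + 12uw³ + w⁴ ≡ w⁴ (mod u)`, `≡ u⁴ (mod w)`, and the polynomial identity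
  `c₄ = 5u²w² + Q · (u² − uw − w²)` (`c₄_eq_five_mul_add`) gives `c₄ ≡ 5u²w² (mod Q)`, while
  `gcd(u, w) = 1` and a prime of `Q` divides neither `u` nor `w`; hence the equation is minimal at
  `p` with multiplicative reduction, `f_p = 1`, `p ∣ N_W` (Tate's algorithm, Silverman AEC
  VII.5.1(b); tree: `WeierstrassCurve.conductorExponent_eq_one_of_dvd_Δ_of_not_dvd_c₄`); the prime
  `5` is absorbed by the factor `5`.

HONESTY. Local bookkeeping on the rational-5-torsion class 𝒯₅ for a CLASS RECORD at abc distance 0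
(the refuter's instrument ENG-T5-SZPIRO, kit j300264: 0 violations on 76 094 curves — computed ≠
proved; this file is the proof). It moves no rung of LADDER-ABC (width 0); the class ε-shape it
serves is NOT abc, NOT A-PS (polynomial Szpiro); abc moved by 0; typed ≠ proved.

References: [SilvermanAEC2009] VII.1 Remark 1.1, VII.5 Prop. 5.1(b); [Kubert1976] Table 3.
-/

set_option linter.dupNamespace false

namespace Summit.ABC.ABC.Theorems

open IsDedekindDomain WeierstrassCurve Rat.HeightOneSpectrum UniqueFactorizationMonoid
open Literature.NumberTheory.EllipticCurves Literature.NumberTheory.DiophantineGeometry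

namespace FiveTorsionDictionary

/-! ### The integral Tate normal form `⟨w−u, −uw, −uw², 0, 0⟩ / ℤ` -/

/-- `c₄ = u⁴ − 12u³w + 14u²w² + 12uw³ + w⁴` for the integral ℤ/5 model (Kubert's `E(t,t)` scaled by
`w`). [cite: Kubert1976, Table 3] -/
theorem c₄_eq (u w : ℤ) :
    (⟨w - u, -(u * w), -(u * w ^ 2), 0, 0⟩ : WeierstrassCurve ℤ).c₄ =
      u ^ 4 - 12 * u ^ 3 * w + 14 * u ^ 2 * w ^ 2 + 12 * u * w ^ 3 + w ^ 4 := by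
  simp only [WeierstrassCurve.c₄, WeierstrassCurve.b₂, WeierstrassCurve.b₄]
  ring

/-- The key polynomial identity replacing the resultant `Res_t(c₄, t² − 11t − 1) = 25`:
`c₄ = 5u²w² + (u² − 11uw − w²)(u² − uw − w²)`. [folklore] -/
theorem c₄_eq_five_mul_add (u w : ℤ) :
    (⟨w - u, -(u * w), -(u * w ^ 2), 0, 0⟩ : WeierstrassCurve ℤ).c₄ =
      5 * u ^ 2 * w ^ 2 + (u ^ 2 - 11 * u * w - w ^ 2) * (u ^ 2 - u * w - w ^ 2) := by
  rw [c₄_eq]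
  ring

/-- `Δ = u⁵ w⁵ (u² − 11uw − w²)` for the integral ℤ/5 model (dictionary item (D1): the
homogenisation of `Δ(E(t,t)) = t⁵ (t² − 11t − 1)`). [cite: Kubert1976, Table 3] -/
theorem Δ_eq (u w : ℤ) :
    (⟨w - u, -(u * w), -(u * w ^ 2), 0, 0⟩ : WeierstrassCurve ℤ).Δ =
      u ^ 5 * w ^ 5 * (u ^ 2 - 11 * u * w - w ^ 2) := by
  simp only [WeierstrassCurve.Δ, WeierstrassCurve.b₂, WeierstrassCurve.b₄, WeierstrassCurve.b₆,
    WeierstrassCurve.b₈]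
  ring

/-- The integral ℤ/5 model base-changed to `ℚ` is the route's `W(u, w) / ℚ`. [folklore] -/
theorem baseChange_eq (u w : ℤ) :
    (⟨w - u, -(u * w), -(u * w ^ 2), 0, 0⟩ : WeierstrassCurve ℤ).baseChange ℚ =
      ⟨((w : ℚ) - (u : ℚ)), (-((u : ℚ) * (w : ℚ))), (-((u : ℚ) * (w : ℚ) ^ 2)), 0, 0⟩ := by
  ext <;> simp [WeierstrassCurve.baseChange, WeierstrassCurve.map]

/-! ### Primes `p ≠ 5` of the three cusp forms do not divide `c₄` -/

/-- For coprime `u, w` and a prime `p ≠ 5` dividing `u w (u² − 11uw − w²)`: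
`p ∤ c₄ = u⁴ − 12u³w + 14u²w² + 12uw³ + w⁴` (`c₄ ≡ w⁴ (mod u)`, `≡ u⁴ (mod w)`,
`≡ 5u²w² (mod u² − 11uw − w²)`). [folklore] -/
theorem not_dvd_c₄ {u w : ℤ} (huw : IsCoprime u w) {p : ℕ} (hp : p.Prime) (h5 : p ≠ 5)
    (h : (p : ℤ) ∣ u * w * (u ^ 2 - 11 * u * w - w ^ 2)) :
    ¬ (p : ℤ) ∣ (⟨w - u, -(u * w), -(u * w ^ 2), 0, 0⟩ : WeierstrassCurve ℤ).c₄ := by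
  intro hc
  have hpint : Prime (p : ℤ) := Nat.prime_iff_prime_int.mp hp
  -- `p` cannot divide both `u` and `w`
  have key : ¬ ((p : ℤ) ∣ u ∧ (p : ℤ) ∣ w) := fun ⟨hu, hw⟩ =>
    hpint.not_unit (huw.isUnit_of_dvd' hu hw)
  rcases hpint.dvd_or_dvd h with h₁ | hQ
  · rw [c₄_eq] at hc
    rcases hpint.dvd_or_dvd h₁ with hu | hw
    · -- `p ∣ u`: `c₄ = u·(…) + w⁴`
      have h1 : (p : ℤ) ∣ u ^ 4 - 12 * u ^ 3 * w + 14 * u ^ 2 * w ^ 2 + 12 * u * w ^ 3 + w ^ 4 -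
          u * (u ^ 3 - 12 * u ^ 2 * w + 14 * u * w ^ 2 + 12 * w ^ 3) :=
        dvd_sub hc (dvd_mul_of_dvd_left hu _)
      have h2 : u ^ 4 - 12 * u ^ 3 * w + 14 * u ^ 2 * w ^ 2 + 12 * u * w ^ 3 + w ^ 4 -
          u * (u ^ 3 - 12 * u ^ 2 * w + 14 * u * w ^ 2 + 12 * w ^ 3) = w ^ 4 := by ring
      rw [h2] at h1
      exact key ⟨hu, hpint.dvd_of_dvd_pow h1⟩
    · -- `p ∣ w`: `c₄ = w·(…) + u⁴`
      have h1 : (p : ℤ) ∣ u ^ 4 - 12 * u ^ 3 * w + 14 * u ^ 2 * w ^ 2 + 12 * u * w ^ 3 + w ^ 4 -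
          w * (-12 * u ^ 3 + 14 * u ^ 2 * w + 12 * u * w ^ 2 + w ^ 3) :=
        dvd_sub hc (dvd_mul_of_dvd_left hw _)
      have h2 : u ^ 4 - 12 * u ^ 3 * w + 14 * u ^ 2 * w ^ 2 + 12 * u * w ^ 3 + w ^ 4 -
          w * (-12 * u ^ 3 + 14 * u ^ 2 * w + 12 * u * w ^ 2 + w ^ 3) = u ^ 4 := by ring
      rw [h2] at h1
      exact key ⟨hpint.dvd_of_dvd_pow h1, hw⟩
  · -- `p ∣ Q = u² − 11uw − w²`: `c₄ = 5u²w² + Q·(u² − uw − w²)`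
    rw [c₄_eq_five_mul_add] at hc
    have h1 : (p : ℤ) ∣ 5 * u ^ 2 * w ^ 2 + (u ^ 2 - 11 * u * w - w ^ 2) * (u ^ 2 - u * w - w ^ 2) -
        (u ^ 2 - 11 * u * w - w ^ 2) * (u ^ 2 - u * w - w ^ 2) :=
      dvd_sub hc (dvd_mul_of_dvd_left hQ _)
    have h2 : 5 * u ^ 2 * w ^ 2 + (u ^ 2 - 11 * u * w - w ^ 2) * (u ^ 2 - u * w - w ^ 2) -
        (u ^ 2 - 11 * u * w - w ^ 2) * (u ^ 2 - u * w - w ^ 2) = 5 * u ^ 2 * w ^ 2 := by ring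
    rw [h2] at h1
    -- a prime of `Q` dividing `u` divides `w² = u(u − 11w) − Q`, and vice versa
    have hQu : (p : ℤ) ∣ u → (p : ℤ) ∣ w := fun hu => by
      have h3 : (p : ℤ) ∣ u * (u - 11 * w) - (u ^ 2 - 11 * u * w - w ^ 2) :=
        dvd_sub (dvd_mul_of_dvd_left hu _) hQ
      have h4 : u * (u - 11 * w) - (u ^ 2 - 11 * u * w - w ^ 2) = w ^ 2 := by ring
      rw [h4] at h3
      exact hpint.dvd_of_dvd_pow h3
    have hQw : (p : ℤ) ∣ w → (p : ℤ) ∣ u := fun hw => by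
      have h3 : (p : ℤ) ∣ (u ^ 2 - 11 * u * w - w ^ 2) + w * (11 * u + w) :=
        dvd_add hQ (dvd_mul_of_dvd_left hw _)
      have h4 : (u ^ 2 - 11 * u * w - w ^ 2) + w * (11 * u + w) = u ^ 2 := by ring
      rw [h4] at h3
      exact hpint.dvd_of_dvd_pow h3
    rcases hpint.dvd_or_dvd h1 with h5u | hw2
    · rcases hpint.dvd_or_dvd h5u with h55 | hu2
      · -- `p ∣ 5`
        have : p ∣ 5 := by exact_mod_cast h55
        exact h5 ((Nat.prime_dvd_prime_iff_eq hp (by norm_num)).mp this)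
      · have hu : (p : ℤ) ∣ u := hpint.dvd_of_dvd_pow hu2
        exact key ⟨hu, hQu hu⟩
    · have hw : (p : ℤ) ∣ w := hpint.dvd_of_dvd_pow hw2
      exact key ⟨hQw hw, hw⟩

/-- **Tate's algorithm away from `5` on the ℤ/5 Tate normal form** (Silverman AEC VII.5.1(b)): for
coprime `u, w` with the integral equation elliptic over `ℚ` and a prime `p ≠ 5` dividing
`u w (u² − 11uw − w²)`, the equation is minimal at `p` with multiplicative reduction, so `f_p = 1`
and `p ∣ N` (dictionary item (D2)). [cite: SilvermanAEC2009, VII.5 Prop. 5.1(b)] -/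
theorem dvd_conductorNorm_of_prime {u w : ℤ} (huw : IsCoprime u w)
    [((⟨w - u, -(u * w), -(u * w ^ 2), 0, 0⟩ : WeierstrassCurve ℤ).baseChange ℚ).IsElliptic]
    {p : ℕ} (hp : p.Prime) (h5 : p ≠ 5) (h : (p : ℤ) ∣ u * w * (u ^ 2 - 11 * u * w - w ^ 2)) :
    p ∣ ((⟨w - u, -(u * w), -(u * w ^ 2), 0, 0⟩ : WeierstrassCurve ℤ).baseChange ℚ).conductorNorm ℤ := by
  set W₀ : WeierstrassCurve ℤ := ⟨w - u, -(u * w), -(u * w ^ 2), 0, 0⟩ with hW₀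
  obtain ⟨v, hv⟩ := exists_place ⟨p, hp⟩
  simp only at hv
  have hc₄ : ¬ (natGenerator v : ℤ) ∣ W₀.c₄ := by
    rw [hv]; exact not_dvd_c₄ huw hp h5 h
  have hΔ : (natGenerator v : ℤ) ∣ W₀.Δ := by
    rw [hv, hW₀, Δ_eq]
    exact h.trans (Dvd.intro (u ^ 4 * w ^ 4) (by ring))
  have hmin : (W₀.baseChange ℚ).IsMinimalAt v := isMinimalAt_baseChange_int_of_not_dvd_c₄ hc₄
  have hf : (W₀.baseChange ℚ).conductorExponent v = 1 :=
    conductorExponent_eq_one_of_dvd_Δ_of_not_dvd_c₄ hmin hΔ hc₄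
  have hfac := factorization_conductorNorm_holds (W₀.baseChange ℚ) v
  rw [hv, hf] at hfac
  have hN : (W₀.baseChange ℚ).conductorNorm ℤ ≠ 0 := (conductorNorm_pos_holds (W₀.baseChange ℚ)).ne'
  exact (hp.dvd_iff_one_le_factorization hN).mpr hfac.ge

/-- **The dictionary, conductor half**: for coprime `u, w` with `u w (u² − 11uw − w²) ≠ 0` and the
integral ℤ/5 model elliptic over `ℚ`, `rad(u w (u² − 11uw − w²)) ∣ 5 · N` (primes `p ≠ 5` by
`dvd_conductorNorm_of_prime`, the prime `5` by the factor `5`).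
[cite: SilvermanAEC2009, VII.5 Prop. 5.1(b)] -/
theorem radical_natAbs_dvd_five_mul_conductorNorm {u w : ℤ} (huw : IsCoprime u w)
    (h0 : u * w * (u ^ 2 - 11 * u * w - w ^ 2) ≠ 0)
    [((⟨w - u, -(u * w), -(u * w ^ 2), 0, 0⟩ : WeierstrassCurve ℤ).baseChange ℚ).IsElliptic] :
    (radical (u * w * (u ^ 2 - 11 * u * w - w ^ 2))).natAbs ∣
      5 * ((⟨w - u, -(u * w), -(u * w ^ 2), 0, 0⟩ : WeierstrassCurve ℤ).baseChange ℚ).conductorNorm ℤ := by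
  set m : ℤ := u * w * (u ^ 2 - 11 * u * w - w ^ 2) with hm
  have hm0 : m.natAbs ≠ 0 := Int.natAbs_ne_zero.mpr h0
  have hrad : (radical m).natAbs = radical m.natAbs := by
    rw [← Int.radical_natAbs_eq_radical, Int.natAbs_natCast]
  rw [hrad]
  have hN : ((⟨w - u, -(u * w), -(u * w ^ 2), 0, 0⟩ : WeierstrassCurve ℤ).baseChange ℚ).conductorNorm ℤ ≠ 0 :=
    (conductorNorm_pos_holds _).ne'
  have h5N : 5 * ((⟨w - u, -(u * w), -(u * w ^ 2), 0, 0⟩ : WeierstrassCurve ℤ).baseChange ℚ).conductorNorm ℤ ≠ 0 :=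
    mul_ne_zero (by norm_num) hN
  -- every prime of `m` divides `5 N`
  have key : ∀ p : ℕ, p.Prime → p ∣ m.natAbs →
      p ∣ 5 * ((⟨w - u, -(u * w), -(u * w ^ 2), 0, 0⟩ : WeierstrassCurve ℤ).baseChange ℚ).conductorNorm ℤ := by
    intro p hp hpm
    by_cases hp5 : p = 5
    · subst hp5; exact dvd_mul_right 5 _
    · exact dvd_mul_of_dvd_right
        (dvd_conductorNorm_of_prime huw hp hp5 (Int.natCast_dvd.mpr hpm)) 5
  -- hence the radical (product of the distinct primes of `m`) divides `5 N`
  rw [← Nat.factorization_le_iff_dvd radical_ne_zero h5N]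
  intro p
  by_cases hp : p.Prime
  · rw [factorization_radical_apply hm0 hp]
    split_ifs with hpn
    · exact (hp.dvd_iff_one_le_factorization h5N).mp (key p hp hpn)
    · exact Nat.zero_le _
  · simp [Nat.factorization_eq_zero_of_not_prime _ hp]

/-- **The dictionary, discriminant half**: `|Δ_min(W)| ≤ |u⁵ w⁵ (u² − 11uw − w²)|` as real numbers
for the integral ℤ/5 model elliptic over `ℚ` (dictionary item (D1): the right-hand side is `|Δ|`
of the integral equation, and `Δ_min ∣ Δ(W₀)` prime by prime).
[cite: SilvermanAEC2009, VII.1 Remark 1.1] -/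
theorem cast_minimalDiscriminantNorm_le (u w : ℤ)
    [((⟨w - u, -(u * w), -(u * w ^ 2), 0, 0⟩ : WeierstrassCurve ℤ).baseChange ℚ).IsElliptic] :
    ((((⟨w - u, -(u * w), -(u * w ^ 2), 0, 0⟩ : WeierstrassCurve ℤ).baseChange ℚ).minimalDiscriminantNorm ℤ : ℕ) : ℝ) ≤
      |(u : ℝ) ^ 5 * (w : ℝ) ^ 5 * ((u : ℝ) ^ 2 - 11 * (u : ℝ) * (w : ℝ) - (w : ℝ) ^ 2)| := by
  set W₀ : WeierstrassCurve ℤ := ⟨w - u, -(u * w), -(u * w ^ 2), 0, 0⟩ with hW₀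
  have hΔ0 : W₀.Δ ≠ 0 := Δ_ne_zero_of_isElliptic_baseChange_int W₀
  -- `Δ_min ∣ Δ(W₀)` prime by prime (Silverman AEC VII.1 Remark 1.1)
  have hdvd : (W₀.baseChange ℚ).minimalDiscriminantNorm ℤ ∣ W₀.Δ.natAbs := by
    have hD0 : (W₀.baseChange ℚ).minimalDiscriminantNorm ℤ ≠ 0 :=
      (minimalDiscriminantNorm_pos_holds _).ne'
    rw [← Nat.factorization_le_iff_dvd hD0 (Int.natAbs_ne_zero.mpr hΔ0)]
    intro p
    by_cases hp : p.Prime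
    · obtain ⟨v, hv⟩ := exists_place ⟨p, hp⟩
      have hfac := factorization_minimalDiscriminantNorm_holds (W₀.baseChange ℚ) v
      obtain ⟨k, hk, -, -⟩ := exists_ordMinimalDiscriminant_add_eq_padicValInt v W₀
      haveI : Fact (natGenerator v).Prime := ⟨prime_natGenerator v⟩
      have hval : padicValInt (natGenerator v) W₀.Δ =
          W₀.Δ.natAbs.factorization (natGenerator v) := by
        rw [padicValInt, Nat.factorization_def _ (prime_natGenerator v)]
      simp only at hv
      rw [← hv, hfac, ← hval]
      omega
    · simp [Nat.factorization_eq_zero_of_not_prime _ hp]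
  have h1 : (W₀.baseChange ℚ).minimalDiscriminantNorm ℤ ≤ W₀.Δ.natAbs :=
    Nat.le_of_dvd (Int.natAbs_pos.mpr hΔ0) hdvd
  have h2 : ((W₀.Δ.natAbs : ℕ) : ℝ) =
      |(u : ℝ) ^ 5 * (w : ℝ) ^ 5 * ((u : ℝ) ^ 2 - 11 * (u : ℝ) * (w : ℝ) - (w : ℝ) ^ 2)| := by
    rw [Nat.cast_natAbs, Int.cast_abs, hW₀, Δ_eq]
    push_cast
    rfl
  rw [← h2]
  exact_mod_cast h1

/-- **The five-torsion dictionary** (unfolded form of the route decl): for coprime `u, w` with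
`u w (u² − 11uw − w²) ≠ 0` and every elliptic `W = ⟨w−u, −uw, −uw², 0, 0⟩ / ℚ`,
`|Δ_min(W)| ≤ |u⁵ w⁵ (u² − 11uw − w²)|` and `rad(u w (u² − 11uw − w²)) ∣ 5 · N_W`.
[cite: SilvermanAEC2009, VII.1 Remark 1.1 and VII.5 Prop. 5.1(b)] -/
theorem fiveTorsionDictionary (u w : ℤ) (huw : IsCoprime u w)
    (h0 : u * w * (u ^ 2 - 11 * u * w - w ^ 2) ≠ 0) (W : WeierstrassCurve ℚ) [W.IsElliptic]
    (hW : W = ⟨((w : ℚ) - (u : ℚ)), (-((u : ℚ) * (w : ℚ))), (-((u : ℚ) * (w : ℚ) ^ 2)), 0, 0⟩) :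
    (W.minimalDiscriminantNorm ℤ : ℝ) ≤
        |(u : ℝ) ^ 5 * (w : ℝ) ^ 5 * ((u : ℝ) ^ 2 - 11 * (u : ℝ) * (w : ℝ) - (w : ℝ) ^ 2)| ∧
      (radical (u * w * (u ^ 2 - 11 * u * w - w ^ 2))).natAbs ∣ 5 * W.conductorNorm ℤ := by
  have hW' : W = (⟨w - u, -(u * w), -(u * w ^ 2), 0, 0⟩ : WeierstrassCurve ℤ).baseChange ℚ :=
    hW.trans (baseChange_eq u w).symm
  subst hW'
  exact ⟨cast_minimalDiscriminantNorm_le u w, radical_natAbs_dvd_five_mul_conductorNorm huw h0⟩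

end FiveTorsionDictionary

/-- **stmt-ABC-26028 `FiveTorsionDictionary` of route `CuspFieldPencil`**: Tate's algorithm away
from `5` on the ℤ/5 Tate normal form — `|Δ_min(W)| ≤ |u⁵w⁵(u²−11uw−w²)|` and
`rad(uw(u²−11uw−w²)) ∣ 5·N_W` for coprime `u, w`. Library bookkeeping on a torsion class for a
class record at abc distance 0; NOT abc, NOT A-PS, moves no rung.
[cite: SilvermanAEC2009, VII.1 Remark 1.1 and VII.5 Prop. 5.1(b)] -/
theorem fiveTorsionDictionary_proof :
    Summit.ABC.ABC.Theses.CuspFieldPencil.FiveTorsionDictionary := by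
  unfold Summit.ABC.ABC.Theses.CuspFieldPencil.FiveTorsionDictionary
  intro u w huw h0 W _ hW
  exact FiveTorsionDictionary.fiveTorsionDictionary u w huw h0 W hW

end Summit.ABC.ABC.Theorems
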